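import Mathlib
import Summits.NavierStokesRegularity.NavierStokesRegularity.Theorems.HeteroclinicTriggerChainTriggerChainFrontStepTruncPassageSharp
import Summits.NavierStokesRegularity.NavierStokesRegularity.Theorems.HeteroclinicTriggerChainTriggerChainFrontStepTruncFullHop
import HarnessLib

/-!
# `HeteroclinicTriggerChain` — crux `TriggerChainFrontStep` (item stmt-NavierStokesRegularity-22785):
  ignition and the full hop of the seeded two-shell truncation with the SHARP delay budget

The ignition lemma and the hop composition of `…TruncIgnition` / `…TruncFullHop`, re-run on the sharp
delay-phase theorem of `…TruncPassageSharp`: the amplification budget of the upper trigger during the delay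
is `2Λ ≥ 2e′(y(0)+ν)T_max + e′gh²/e²` (only the initial receiver residue is amplified over the long delay),
so the ignition level `h` can be taken `O(1)` (`h ≤ 0.35`) uniformly in the seed size.
* `heteroclinicTriggerChain_trunc_ignition_exists_sharp` — first ignition time, timing law, state at
  ignition with the regenerated seed;
* `heteroclinicTriggerChain_trunc_fullHop_sharp` — delay → ignition → first capture (composition with the
  sibling seat's `heteroclinicTriggerChain_trunc_hop_capture`, `g = e`).
CONSTANTS (honest): with `h ≍ 0.3` the capture lemma runs with trigger energy `m ≍ h² ≍ 0.1`, so the transfer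
window is `T ≍ (1+L)/(2em)` and the transfer amplification `e^{e′T}` is `e^{O(30(1+L))}` for
`e′ = 2^{5/2}e`; the truncated hop map therefore closes (forcing `φ = 2βV + e′V² < 2em`) only for
`β ≲ e^{−40}` — enough for an `∃ β` statement, far from the numerics' `β = 10⁻³`; a capture lemma by
closeness to the logistic arc (transfer time `O(log(1/h)/e)`) would remove this.

HONEST FRAMING: elementary real analysis of a four-dimensional quadratic ODE (a MODEL truncation of Tao's
lattice, Tao 2016 §4); helper for the crux (no stub credit); nothing here is a statement about the
Navier–Stokes equations; no summit, rung or crux is proved. NS regularity is not proved by this line.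
-/

noncomputable section

-- the sub-problem namespace `Summit.NavierStokesRegularity.NavierStokesRegularity` repeats the summit name by design (D-0017)
set_option linter.dupNamespace false

open Real Set

namespace Summit.NavierStokesRegularity.NavierStokesRegularity.Theorems

/-- **IGNITION HAPPENS, ON TIME, WITH A REGENERATED SEED — sharp amplification budget** (helper for
item stmt-NavierStokesRegularity-22785; as `heteroclinicTriggerChain_trunc_ignition_exists` with the budget
`2Λ ≥ 2e′(y(0)+ν)T_max + e′gh²/e²` of `heteroclinicTriggerChain_trunc_delayPhase_sharp`). In the seeded two-shell truncation (`e, g > 0`, `e′, β ≥ 0`, energy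
`≤ 1`, `0 < u(0) < h`, `y(0), v(0) ≥ 0`) with the constants of `heteroclinicTriggerChain_trunc_delayPhase`
chosen for a horizon `T_max` (`Λ ≥ e′δ₂T_max`) that exceeds the slow ignition bound,
`log(h/u(0))/(e(1−ε)) < T_max` (`ε = δ₁ + gδ₂/e`): there is a first ignition time `T_h`,
`0 < T_h ≤ T_max`, `u(T_h) = h`, `u < h` on `[0, T_h)`, with
`log(h/u(0))/e ≤ T_h ≤ log(h/u(0))/(e(1−ε))`, and at ignition `1 − δ₁ ≤ x ≤ 1`, `y(0) ≤ y ≤ δ₂`,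
`v(0) + β(1−δ₁)(h − u(0))/e ≤ v ≤ e^{2Λ}(v(0) + 2βh/e)`. [folklore] -/
theorem heteroclinicTriggerChain_trunc_ignition_exists_sharp (e g e' β : ℝ) (he : 0 < e) (hg : 0 < g)
    (he' : 0 ≤ e') (hβ : 0 ≤ β) (x u y v : ℝ → ℝ)
    (hx : ∀ t, HasDerivAt x (-(e * u t ^ 2) - β * u t * v t) t)
    (hu : ∀ t, HasDerivAt u (e * x t * u t - g * u t * y t) t)
    (hy : ∀ t, HasDerivAt y (g * u t ^ 2 - e' * v t ^ 2) t)
    (hv : ∀ t, HasDerivAt v (β * x t * u t + e' * y t * v t) t)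
    (hE : x 0 ^ 2 + u 0 ^ 2 + y 0 ^ 2 + v 0 ^ 2 ≤ 1)
    (hu0 : 0 < u 0) (hy0 : 0 ≤ y 0) (hv0 : 0 ≤ v 0)
    {Tmax h Λ δ₁ δ₂ V ν : ℝ} (huh0 : u 0 < h) (hν : 0 < ν)
    (hδ₂ : y 0 + ν + g * h ^ 2 / e ≤ δ₂) (hΛT : 2 * e' * (y 0 + ν) * Tmax + e' * g * h ^ 2 / e ^ 2 ≤ 2 * Λ)
    (hV : Real.exp (2 * Λ) * (v 0 + 2 * β * h / e) ≤ V)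
    (hδ₁ : 1 - x 0 + h ^ 2 + 2 * β * V * h / e ≤ δ₁)
    (hsmall : 2 * δ₁ + 2 * g * δ₂ / e ≤ 1 / 2)
    (hv0u0 : 4 * e' * Real.exp (4 * Λ) * v 0 ^ 2 ≤ g * u 0 ^ 2)
    (hβe : 16 * e' * β ^ 2 * Real.exp (4 * Λ) ≤ g * e ^ 2)
    (hTmax : Real.log (h / u 0) / (e * (1 - (δ₁ + g * δ₂ / e))) < Tmax) :
    ∃ T : ℝ, 0 < T ∧ T ≤ Tmax ∧ u T = h ∧ (∀ s ∈ Ico 0 T, u s < h) ∧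
      Real.log (h / u 0) / e ≤ T ∧ T ≤ Real.log (h / u 0) / (e * (1 - (δ₁ + g * δ₂ / e))) ∧
      1 - δ₁ ≤ x T ∧ x T ≤ 1 ∧ y 0 ≤ y T ∧ y T ≤ δ₂ ∧
      v 0 + β * (1 - δ₁) * (h - u 0) / e ≤ v T ∧ v T ≤ Real.exp (2 * Λ) * (v 0 + 2 * β * h / e) := by
  have huc : Continuous u := continuous_iff_continuousAt.2 fun t => (hu t).continuousAt
  have hhpos : 0 < h := hu0.trans huh0
  have hδ₂nn : 0 ≤ δ₂ := by
    have : 0 ≤ g * h ^ 2 / e := by positivity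
    linarith
  -- the slow ignition bound is nonnegative, so the horizon is positive
  have hεpos : 0 < 1 - (δ₁ + g * δ₂ / e) := by
    have h2 : 2 * (δ₁ + g * δ₂ / e) = 2 * δ₁ + 2 * g * δ₂ / e := by ring
    linarith
  have hlog : 0 ≤ Real.log (h / u 0) := Real.log_nonneg (by rw [le_div_iff₀ hu0]; linarith)
  have hTmax0 : 0 ≤ Tmax := le_trans (div_nonneg hlog (mul_pos he hεpos).le) hTmax.le
  -- the set of ignited times in [0, Tmax] is nonempty (else the lower exponential law overshoots)
  set S : Set ℝ := Icc 0 Tmax ∩ u ⁻¹' Ici h with hS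
  have hSne : S.Nonempty := by
    by_contra hemp
    rw [Set.not_nonempty_iff_eq_empty] at hemp
    have hle : ∀ s ∈ Icc 0 Tmax, u s ≤ h := by
      intro s hs
      by_contra hcon
      push Not at hcon
      have hmem : s ∈ S := ⟨hs, hcon.le⟩
      rw [hemp] at hmem
      exact hmem
    have h1 := (heteroclinicTriggerChain_trunc_ignitionTime_sharp e g e' β he hg he' hβ x u y v hx hu hy hv
      hE hu0 hy0 hv0 hTmax0 hν hδ₂ hΛT hV hδ₁ hsmall hv0u0 hβe hle).1
    linarith
  have hSbdd : BddBelow S := ⟨0, fun s hs => hs.1.1⟩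
  have hSclosed : IsClosed S := isClosed_Icc.inter (isClosed_Ici.preimage huc)
  obtain ⟨⟨hT0, hTTmax⟩, hTh⟩ : sInf S ∈ S := hSclosed.csInf_mem hSne hSbdd
  set T : ℝ := sInf S with hTdef
  have hTh' : h ≤ u T := hTh
  have hbefore : ∀ s ∈ Ico 0 T, u s < h := by
    intro s hs
    by_contra hcon
    push Not at hcon
    have hmem : s ∈ S := ⟨⟨hs.1, hs.2.le.trans hTTmax⟩, hcon⟩
    exact absurd (csInf_le hSbdd hmem) (not_le.2 hs.2)
  have hTpos : 0 < T := by
    rcases hT0.eq_or_lt with h0 | h0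
    · exfalso
      rw [← h0] at hTh'
      linarith
    · exact h0
  -- continuity from the left: u(T) ≤ h
  have huT : u T = h := by
    refine le_antisymm ?_ hTh'
    have hsub : Ico 0 T ⊆ u ⁻¹' Iic h := fun s hs => (hbefore s hs).le
    have hcl : closure (Ico 0 T) ⊆ u ⁻¹' Iic h :=
      (isClosed_Iic.preimage huc).closure_subset_iff.2 hsub
    have hTcl : T ∈ closure (Ico 0 T) := by
      rw [closure_Ico hTpos.ne]
      exact ⟨hTpos.le, le_rfl⟩
    exact hcl hTcl
  have hle : ∀ s ∈ Icc 0 T, u s ≤ h := by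
    intro s hs
    rcases hs.2.eq_or_lt with h1 | h1
    · rw [h1, huT]
    · exact (hbefore s ⟨hs.1, h1⟩).le
  have hΛT' : 2 * e' * (y 0 + ν) * T + e' * g * h ^ 2 / e ^ 2 ≤ 2 * Λ := by
    have hY : (0 : ℝ) ≤ 2 * e' * (y 0 + ν) := by
      have : 0 ≤ y 0 + ν := by linarith
      positivity
    have := mul_le_mul_of_nonneg_left hTTmax hY
    linarith
  have hmem : T ∈ Icc 0 T := ⟨hTpos.le, le_rfl⟩
  obtain ⟨h1, h2, h3, h4, -, -, h7, -, -, h10, -⟩ :=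
    heteroclinicTriggerChain_trunc_delayPhase_sharp e g e' β he hg he' hβ x u y v hx hu hy hv hE hu0 hy0 hv0
      hTpos.le hν hδ₂ hΛT' hV hδ₁ hsmall hv0u0 hβe hle T hmem
  obtain ⟨h11, h12⟩ :=
    heteroclinicTriggerChain_trunc_ignitionTime_sharp e g e' β he hg he' hβ x u y v hx hu hy hv hE hu0 hy0
      hv0 hTpos.le hν hδ₂ hΛT' hV hδ₁ hsmall hv0u0 hβe hle
  refine ⟨T, hTpos, hTTmax, huT, hbefore, h12 huT, h11, h1, h2, h3, h4, ?_, ?_⟩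
  · rw [huT] at h10
    exact h10
  · rw [huT] at h7
    exact h7

/-- **THE FULL HOP OF THE SEEDED TWO-SHELL TRUNCATION, sharp delay budget: delay → ignition → capture**
(helper for item stmt-NavierStokesRegularity-22785; `g = e`, `e, e′ > 0`, `β ≥ 0`, energy `≤ 1`,
`0 < u(0) < h`, `y(0), v(0) ≥ 0`). DELAY CONSTANTS (as in `heteroclinicTriggerChain_trunc_delayPhase_sharp`
with `g = e`): free `ν > 0`, `δ₂ ≥ y(0) + ν + h²`, horizon `T_max` with SHARP budget
`2Λ ≥ 2e′(y(0)+ν)T_max + e′h²/e`, `V_d ≥ e^{2Λ}(v(0) + 2βh/e)`,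
`δ₁ ≥ 1 − x(0) + h² + 2βV_d h/e`, `2δ₁ + 2δ₂ ≤ 1/2`, `4e′e^{4Λ}v(0)² ≤ e u(0)²`, `16e′β²e^{4Λ} ≤ e³`,
`log(h/u(0))/(e(1 − (δ₁+δ₂))) < T_max`. TRANSFER CONSTANTS (as in
`heteroclinicTriggerChain_trunc_hop_capture` at the ignition state): window `T ≥ (1+L)/(2em − φ)`, upper
trigger ceiling `V ≥ gronwallBound V_d e′ β T`, forcing `φ = 2βV + e′V²` with `φ < 2em`, trigger energy
`2m + 12φT ≤ 2h²`, capture level `0 ≤ L`, `L² + 2m + 12φT ≤ (1 − δ₁ − δ₂)² + 2h²`, `L + δ₁ + φT ≤ 1`.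
CONCLUSION: ignition time `T_h` and first capture time `T_c` with the properties listed in the module
docstring. [folklore] -/
theorem heteroclinicTriggerChain_trunc_fullHop_sharp (e e' β : ℝ) (he : 0 < e) (he' : 0 < e') (hβ : 0 ≤ β)
    (x u y v : ℝ → ℝ)
    (hx : ∀ t, HasDerivAt x (-(e * u t ^ 2) - β * u t * v t) t)
    (hu : ∀ t, HasDerivAt u (e * x t * u t - e * u t * y t) t)
    (hy : ∀ t, HasDerivAt y (e * u t ^ 2 - e' * v t ^ 2) t)
    (hv : ∀ t, HasDerivAt v (β * x t * u t + e' * y t * v t) t)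
    (hE : x 0 ^ 2 + u 0 ^ 2 + y 0 ^ 2 + v 0 ^ 2 ≤ 1)
    (hu0 : 0 < u 0) (hy0 : 0 ≤ y 0) (hv0 : 0 ≤ v 0)
    {Tmax h Λ δ₁ δ₂ Vd T V φ m L ν : ℝ} (huh0 : u 0 < h) (hν : 0 < ν)
    (hδ₂ : y 0 + ν + h ^ 2 ≤ δ₂) (hΛT : 2 * e' * (y 0 + ν) * Tmax + e' * h ^ 2 / e ≤ 2 * Λ)
    (hVd : Real.exp (2 * Λ) * (v 0 + 2 * β * h / e) ≤ Vd)
    (hδ₁ : 1 - x 0 + h ^ 2 + 2 * β * Vd * h / e ≤ δ₁)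
    (hsmall : 2 * δ₁ + 2 * δ₂ ≤ 1 / 2)
    (hv0u0 : 4 * e' * Real.exp (4 * Λ) * v 0 ^ 2 ≤ e * u 0 ^ 2)
    (hβe : 16 * e' * β ^ 2 * Real.exp (4 * Λ) ≤ e ^ 3)
    (hTmax : Real.log (h / u 0) / (e * (1 - (δ₁ + δ₂))) < Tmax)
    (hT : 0 ≤ T) (hV : gronwallBound Vd e' β T ≤ V) (hφ : φ = 2 * β * V + e' * V ^ 2)
    (hφm : φ < 2 * e * m) (hm : 2 * m + 12 * φ * T ≤ 2 * h ^ 2) (hL0 : 0 ≤ L)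
    (hL : L ^ 2 + 2 * m + 12 * φ * T ≤ (1 - δ₁ - δ₂) ^ 2 + 2 * h ^ 2)
    (hL1 : L + δ₁ + φ * T ≤ 1) (hTT : (1 + L) / (2 * e * m - φ) ≤ T) :
    ∃ Th Tc : ℝ, 0 < Th ∧ Th ≤ Tmax ∧ Th ≤ Tc ∧ Tc ≤ Th + T ∧
      u Th = h ∧ (∀ s ∈ Ico 0 Th, u s < h) ∧
      Real.log (h / u 0) / e ≤ Th ∧ Th ≤ Real.log (h / u 0) / (e * (1 - (δ₁ + δ₂))) ∧
      x Tc - y Tc = -L ∧ (∀ s ∈ Ico Th Tc, -L < x s - y s) ∧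
      1 - δ₁ + y 0 + L - φ * (Tc - Th) ≤ 2 * y Tc ∧
      (∀ s ∈ Icc Th (Th + T), |v s| ≤ V) ∧
      (v 0 + β * (1 - δ₁) * (h - u 0) / e) * Real.exp (-((e' * V) ^ 2 * T * T)) ≤ v Tc := by
  have hxc : Continuous x := continuous_iff_continuousAt.2 fun t => (hx t).continuousAt
  have huc : Continuous u := continuous_iff_continuousAt.2 fun t => (hu t).continuousAt
  have hyc : Continuous y := continuous_iff_continuousAt.2 fun t => (hy t).continuousAt
  have hhpos : 0 < h := hu0.trans huh0
  -- rewrite the delay hypotheses in the `g = e` instance of the general lemmas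
  have hee : e * h ^ 2 / e = h ^ 2 := by field_simp
  have hδ₂' : y 0 + ν + e * h ^ 2 / e ≤ δ₂ := by rw [hee]; exact hδ₂
  have hee2 : e' * e * h ^ 2 / e ^ 2 = e' * h ^ 2 / e := by field_simp
  have hΛT2 : 2 * e' * (y 0 + ν) * Tmax + e' * e * h ^ 2 / e ^ 2 ≤ 2 * Λ := by rw [hee2]; exact hΛT
  have heδ : e * δ₂ / e = δ₂ := by field_simp
  have hsmall' : 2 * δ₁ + 2 * e * δ₂ / e ≤ 1 / 2 := by
    rw [show 2 * e * δ₂ / e = 2 * (e * δ₂ / e) by ring, heδ]; linarith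
  have hβe' : 16 * e' * β ^ 2 * Real.exp (4 * Λ) ≤ e * e ^ 2 := by
    rw [show e * e ^ 2 = e ^ 3 by ring]; exact hβe
  have hTmax' : Real.log (h / u 0) / (e * (1 - (δ₁ + e * δ₂ / e))) < Tmax := by rw [heδ]; exact hTmax
  -- Step 1: ignition
  obtain ⟨Th, hTh0, hThmax, huTh, hbefore, hThlow, hThup, hxTh, hxTh1, hyTh0, hyTh, hvTh, hvTh'⟩ :=
    heteroclinicTriggerChain_trunc_ignition_exists_sharp e e e' β he he he'.le hβ x u y v hx hu hy hv hE hu0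
      hy0 hv0 huh0 hν hδ₂' hΛT2 hVd hδ₁ hsmall' hv0u0 hβe' hTmax'
  rw [heδ] at hThup
  -- Step 2: the shifted system at the ignition time
  set x₁ : ℝ → ℝ := fun s => x (s + Th) with hx₁
  set u₁ : ℝ → ℝ := fun s => u (s + Th) with hu₁
  set y₁ : ℝ → ℝ := fun s => y (s + Th) with hy₁
  set v₁ : ℝ → ℝ := fun s => v (s + Th) with hv₁
  have hx1 : ∀ t, HasDerivAt x₁ (-(e * u₁ t ^ 2) - β * u₁ t * v₁ t) t := fun t =>
    (hx (t + Th)).comp_add_const t Th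
  have hu1 : ∀ t, HasDerivAt u₁ (e * x₁ t * u₁ t - e * u₁ t * y₁ t) t := fun t =>
    (hu (t + Th)).comp_add_const t Th
  have hy1 : ∀ t, HasDerivAt y₁ (e * u₁ t ^ 2 - e' * v₁ t ^ 2) t := fun t =>
    (hy (t + Th)).comp_add_const t Th
  have hv1 : ∀ t, HasDerivAt v₁ (β * x₁ t * u₁ t + e' * y₁ t * v₁ t) t := fun t =>
    (hv (t + Th)).comp_add_const t Th
  have hEs : ∀ s, x s ^ 2 + u s ^ 2 + y s ^ 2 + v s ^ 2 ≤ 1 := fun s => by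
    rw [heteroclinicTriggerChain_trunc_energy e e e' β x u y v hx hu hy hv s]; exact hE
  have hE1 : x₁ 0 ^ 2 + u₁ 0 ^ 2 + y₁ 0 ^ 2 + v₁ 0 ^ 2 ≤ 1 := by
    simp only [hx₁, hu₁, hy₁, hv₁, zero_add]; exact hEs Th
  have hu10 : u₁ 0 = h := by simp only [hu₁, zero_add]; exact huTh
  have hx10 : x₁ 0 = x Th := by simp only [hx₁, zero_add]
  have hy10 : y₁ 0 = y Th := by simp only [hy₁, zero_add]
  have hv10 : v₁ 0 = v Th := by simp only [hv₁, zero_add]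
  -- sizes at ignition
  have hδ₂nn : 0 ≤ δ₂ := le_trans (by positivity) hδ₂
  have hδ₁le : δ₁ ≤ 1 := by linarith
  have hD0 : 1 - δ₁ - δ₂ ≤ x₁ 0 - y₁ 0 := by rw [hx10, hy10]; linarith
  have hD0' : 0 ≤ 1 - δ₁ - δ₂ := by linarith
  have hD1 : x₁ 0 - y₁ 0 ≤ 1 := by rw [hx10, hy10]; linarith [hyTh0]
  have hvTh_nn : 0 ≤ v Th := le_trans (by
    have : 0 ≤ β * (1 - δ₁) * (h - u 0) / e := by
      have : 0 ≤ 1 - δ₁ := by linarith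
      have : 0 ≤ h - u 0 := by linarith
      positivity
    linarith) hvTh
  -- Step 3: capture (sibling lemma) on the shifted system
  have hVabs : gronwallBound |v₁ 0| e' β T ≤ V := by
    refine le_trans (htcTP_gronwallBound_mono ?_) hV
    rw [hv10, abs_of_nonneg hvTh_nn]
    exact hvTh'.trans hVd
  have hm1 : 2 * m + 12 * φ * T ≤ 2 * u₁ 0 ^ 2 := by rw [hu10]; exact hm
  have hL1' : L ^ 2 + 2 * m + 12 * φ * T ≤ (x₁ 0 - y₁ 0) ^ 2 + 2 * u₁ 0 ^ 2 := by
    rw [hu10]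
    have : (1 - δ₁ - δ₂) ^ 2 ≤ (x₁ 0 - y₁ 0) ^ 2 := pow_le_pow_left₀ hD0' hD0 2
    linarith
  have hden : 0 < 2 * e * m - φ := by linarith
  have hTT1 : (x₁ 0 - y₁ 0 + L) / (2 * e * m - φ) ≤ T :=
    le_trans (div_le_div_of_nonneg_right (by linarith) hden.le) hTT
  obtain ⟨hVwin, t₀, ht₀, hcap, -⟩ :=
    heteroclinicTriggerChain_trunc_hop_capture e e' β he he' hβ x₁ u₁ y₁ v₁ hx1 hu1 hy1 hv1 hE1 hT hVabs
      hφ hφm hm1 hL1' hTT1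
  -- the capture time found lies in [0, T]
  have ht₀T : t₀ ≤ T := by
    refine ht₀.2.trans (max_le hT ?_)
    exact hTT1
  -- Step 4: the FIRST capture time
  have hDc : Continuous fun s => x₁ s - y₁ s :=
    (hxc.comp (continuous_id.add continuous_const)).sub (hyc.comp (continuous_id.add continuous_const))
  have hD0L : -L < x₁ 0 - y₁ 0 := by linarith
  obtain ⟨τ, hτ0, hτt₀, hDτ, hDbefore⟩ := htcTP_first_hit hDc hD0L ht₀.1 hcap
  have hτT : τ ≤ T := hτt₀.trans ht₀T
  -- sizes on the transfer window [0, T] of the shifted system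
  have hE1s : ∀ s, x₁ s ^ 2 + u₁ s ^ 2 + y₁ s ^ 2 + v₁ s ^ 2 ≤ 1 := fun s => by
    simp only [hx₁, hu₁, hy₁, hv₁]; exact hEs (s + Th)
  have hφnn : 0 ≤ φ := by
    have hVnn : 0 ≤ V := le_trans (abs_nonneg _) (hVwin 0 ⟨le_rfl, hT⟩)
    rw [hφ]; positivity
  -- (x + y) drifts down by at most φ per unit time
  have hsum : ∀ s, HasDerivAt (fun q => x₁ q + y₁ q + φ * q)
      ((-(e * u₁ s ^ 2) - β * u₁ s * v₁ s) + (e * u₁ s ^ 2 - e' * v₁ s ^ 2) + φ * 1) s := fun s =>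
    ((hx1 s).add (hy1 s)).add ((hasDerivAt_id' s).const_mul φ)
  have hsum' : ∀ s ∈ Icc 0 T,
      0 ≤ (-(e * u₁ s ^ 2) - β * u₁ s * v₁ s) + (e * u₁ s ^ 2 - e' * v₁ s ^ 2) + φ * 1 := by
    intro s hs
    have hvs : |v₁ s| ≤ V := hVwin s hs
    have hus : |u₁ s| ≤ 1 := (sq_le_one_iff_abs_le_one _).1 (by
      linarith [hE1s s, sq_nonneg (x₁ s), sq_nonneg (y₁ s), sq_nonneg (v₁ s)])
    have h1 : β * u₁ s * v₁ s ≤ β * V := by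
      have h2 : u₁ s * v₁ s ≤ |u₁ s| * |v₁ s| := by
        rw [← abs_mul]; exact le_abs_self _
      have h3 : |u₁ s| * |v₁ s| ≤ 1 * V :=
        mul_le_mul hus hvs (abs_nonneg _) zero_le_one
      have h4 := mul_le_mul_of_nonneg_left (h2.trans h3) hβ
      have h5 : β * u₁ s * v₁ s = β * (u₁ s * v₁ s) := by ring
      rw [h5]
      linarith
    have h2 : e' * v₁ s ^ 2 ≤ e' * V ^ 2 := by
      have : v₁ s ^ 2 ≤ V ^ 2 := by
        rw [← sq_abs (v₁ s)]
        exact pow_le_pow_left₀ (abs_nonneg _) hvs 2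
      exact mul_le_mul_of_nonneg_left this he'.le
    have hVnn : 0 ≤ V := (abs_nonneg _).trans hvs
    have h3 : 0 ≤ β * V := mul_nonneg hβ hVnn
    rw [hφ]
    linarith
  have hsumle := htcTP_le_of_deriv_nonneg hsum hsum'
  -- the receiver does not go far below zero on the window
  have hylow : ∀ s, HasDerivAt (fun q => y₁ q + e' * V ^ 2 * q)
      ((e * u₁ s ^ 2 - e' * v₁ s ^ 2) + e' * V ^ 2 * 1) s := fun s =>
    (hy1 s).add ((hasDerivAt_id' s).const_mul _)
  have hylow' : ∀ s ∈ Icc 0 T, 0 ≤ (e * u₁ s ^ 2 - e' * v₁ s ^ 2) + e' * V ^ 2 * 1 := by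
    intro s hs
    have hvs : |v₁ s| ≤ V := hVwin s hs
    have h1 : v₁ s ^ 2 ≤ V ^ 2 := by
      rw [← sq_abs (v₁ s)]
      exact pow_le_pow_left₀ (abs_nonneg _) hvs 2
    have h2 : 0 ≤ e * u₁ s ^ 2 := by positivity
    have h3 := mul_le_mul_of_nonneg_left h1 he'.le
    linarith
  have hylowle := htcTP_le_of_deriv_nonneg hylow hylow'
  have hyge : ∀ s ∈ Icc 0 τ, -(e' * V ^ 2 * T) ≤ y₁ s := by
    intro s hs
    have h1 := hylowle s ⟨hs.1, hs.2.trans hτT⟩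
    simp only [mul_zero, add_zero] at h1
    have h2 : e' * V ^ 2 * s ≤ e' * V ^ 2 * T :=
      mul_le_mul_of_nonneg_left (hs.2.trans hτT) (by positivity)
    rw [hy10] at h1
    linarith [hyTh0]
  -- the carrier stays nonnegative up to the first capture time
  have hxnn : ∀ s ∈ Icc 0 τ, 0 ≤ x₁ s := by
    intro s hs
    have h1 := hsumle s ⟨hs.1, hs.2.trans hτT⟩
    simp only [mul_zero, add_zero] at h1
    rw [hx10, hy10] at h1
    have h2 : -L ≤ x₁ s - y₁ s := by
      rcases hs.2.eq_or_lt with h3 | h3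
      · rw [h3, hDτ]
      · exact (hDbefore s ⟨hs.1, h3⟩).le
    have h3 : φ * s ≤ φ * T := mul_le_mul_of_nonneg_left (hs.2.trans hτT) hφnn
    linarith [hyTh0]
  -- Step 5: the seed survives the transfer
  have hupos : ∀ s, 0 < u s := fun s => by
    rw [heteroclinicTriggerChain_trunc_trigger_formula e e x u y hxc hyc hu s]
    exact mul_pos hu0 (Real.exp_pos _)
  have hy1c : Continuous y₁ := hyc.comp (continuous_id.add continuous_const)
  have hvlow := htcTP_upper_lower_bound (t := τ) (ybar := e' * V ^ 2 * T) he'.le hv1 hy1c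
    (fun s hs => mul_nonneg (mul_nonneg hβ (hxnn s hs)) (hupos _).le) hyge (by rw [hv10]; exact hvTh_nn)
  have hvτ := hvlow τ ⟨hτ0.le, le_rfl⟩
  -- Step 6: assemble, translating back to absolute time
  refine ⟨Th, τ + Th, hTh0, hThmax, by linarith, by linarith, huTh, hbefore, hThlow, hThup, ?_, ?_, ?_, ?_, ?_⟩
  · -- capture
    exact hDτ
  · -- before capture
    intro s hs
    have h1 := hDbefore (s - Th) ⟨by linarith [hs.1], by linarith [hs.2]⟩
    simp only [hx₁, hy₁, sub_add_cancel] at h1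
    exact h1
  · -- receiver content at capture
    have h1 := hsumle τ ⟨hτ0.le, hτT⟩
    simp only [mul_zero, add_zero] at h1
    rw [hx10, hy10] at h1
    have h2 : τ + Th - Th = τ := by ring
    rw [h2]
    have h3 : x₁ τ = y₁ τ - L := by linarith [hDτ]
    show 1 - δ₁ + y 0 + L - φ * τ ≤ 2 * y (τ + Th)
    have h4 : y₁ τ = y (τ + Th) := rfl
    rw [← h4]
    linarith [hyTh0]
  · -- upper trigger on the transfer window
    intro s hs
    have h1 := hVwin (s - Th) ⟨by linarith [hs.1], by linarith [hs.2]⟩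
    simp only [hv₁, sub_add_cancel] at h1
    exact h1
  · -- the seed handed over
    rw [hv10] at hvτ
    have h1 : Real.exp (-((e' * V) ^ 2 * T * T)) ≤ Real.exp (-(e' * (e' * V ^ 2 * T) * τ)) := by
      rw [Real.exp_le_exp, neg_le_neg_iff]
      have h2 : e' * (e' * V ^ 2 * T) * τ = (e' * V) ^ 2 * T * τ := by ring
      rw [h2]
      exact mul_le_mul_of_nonneg_left hτT (by positivity)
    have h2 : 0 ≤ v 0 + β * (1 - δ₁) * (h - u 0) / e := by
      have : 0 ≤ 1 - δ₁ := by linarith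
      have : 0 ≤ h - u 0 := by linarith
      positivity
    calc (v 0 + β * (1 - δ₁) * (h - u 0) / e) * Real.exp (-((e' * V) ^ 2 * T * T))
        ≤ v Th * Real.exp (-(e' * (e' * V ^ 2 * T) * τ)) :=
          mul_le_mul hvTh h1 (Real.exp_pos _).le hvTh_nn
      _ ≤ v₁ τ := hvτ
      _ = v (τ + Th) := rfl

end Summit.NavierStokesRegularity.NavierStokesRegularity.Theorems

end
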